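import Summits.SmoothPoincare4.SmoothPoincare4.Theorems.EntropyRungNoncompactShrinkerGapHeatEntropyDissipation
import Summits.SmoothPoincare4.SmoothPoincare4.Theorems.EntropyRungNoncompactShrinkerGapHeatEntropyDecayStatic
import Summits.SmoothPoincare4.SmoothPoincare4.Theorems.EntropyRungNoncompactShrinkerGapHeatShrinkerCutoff
import Summits.SmoothPoincare4.SmoothPoincare4.Theorems.EntropyRungNoncompactShrinkerGapHeatTwoSidedBound
import Summits.SmoothPoincare4.SmoothPoincare4.Theorems.EntropyRungNoncompactShrinkerGapHeatGradientDecay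
import Summits.SmoothPoincare4.SmoothPoincare4.Theorems.EntropyRungNoncompactShrinkerGapHeatEnergyEstimate
import Summits.SmoothPoincare4.SmoothPoincare4.Theorems.EntropyRungNoncompactShrinkerGapHeatMassConservation
import Summits.SmoothPoincare4.SmoothPoincare4.Theorems.EntropyRungNoncompactShrinkerGapCarrilloNiClauses
import HarnessLib

/-!
# The Bakry–Émery logarithmic Sobolev inequality for a positive datum `c + ψ₀` along the weighted
# heat flow of a complete gradient shrinker (crux `EntropyRung.NoncompactShrinkerGap`,
# stmt-SmoothPoincare4-10868, line `collapsed-ends-usc`, skeleton v13)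

Registered helper `helper_positiveLSI_of_flow` of the stub `stub_compactSupportLSI` (lead c9): the
a-priori chain of the heat-flow proof, ASSEMBLED. Setting: a complete connected gradient shrinking
Ricci soliton `(Mⁿ, g, f)` (`Ric + Hess f = ½ g`, normalised by `R + |∇f|² = f`, closed `g`-balls
compact), so that the shrinker measure `e^{-f} dV` is a finite `CD(½, ∞)` measure; a datum
`ρ₀ = c + ψ₀` with `c > 0` and `ψ₀ ≥ 0` smooth of compact support; and — as a HYPOTHESIS `hflow`,
discharged by `helper_heatFlowExistence` (lead c8) — for every `T > 0` a solution `ρ` of the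
weighted heat equation `∂ₛρ = Δρ − g⁻¹(df, dρ)` on `[0, T]`, smooth on `M × O` (`O ⊇ [0, T]` open),
with `ρ(0) = ρ₀` and `(ρ − c)² e^{-f} ∈ L¹(M × (0, T))`. CONCLUSION (Bakry–Émery with `K = ½`):

  `∫ ρ₀ log ρ₀ e^{-f} − m log (m / Z) ≤ ∫ |∇ρ₀|² / ρ₀ e^{-f}`,  `m = ∫ ρ₀ e^{-f}`, `Z = ∫ e^{-f}`.

Proof (every step a landed helper of the line): cut-offs `η_k = ψ(f/(k+1))` with `|Δη_k|`,
`|⟨∇f, ∇η_k⟩| ≤ C` (`helper_shrinkerCutoff`); two-sided bounds `c ≤ ρ ≤ c + S` by the weak maximum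
principle (`helper_twoSidedBound`); the energy estimate gives `|∇ρ|² e^{-f} ∈ L¹` of the strip
(`helper_energyEstimate`), whence the gradient decay `|∇ρ(s)|² ≤ e^{-s} G₀` (`helper_gradientDecay`);
conservation of mass (`helper_massConservation`); the dissipation `H(0) − H(T) ≤ I(0)`
(`helper_entropyDissipation`, `1/2K = 1`); and for `T` large the static decay
`H(T) − m log (m/Z) ≤ ε` from the small gradient (`helper_entropyDecay_static`); `ε → 0`.

References: D. Bakry, M. Émery, LNM 1123 (1985); J. A. Carrillo, L. Ni, Comm. Anal. Geom. 17 (2009),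
§3 (pp. 7–8); D. Bakry, I. Gentil, M. Ledoux, *Analysis and Geometry of Markov Diffusion Operators*
(2014), proof of Prop. 5.7.1 (p. 268).
-/

noncomputable section

set_option linter.dupNamespace false

open scoped Manifold ContDiff ENNReal NNReal Topology
open MeasureTheory Set Filter
open Literature.Geometry.Lorentzian Literature.Geometry.Riemannian

namespace Summit.SmoothPoincare4.SmoothPoincare4.Theorems.NoncompactShrinkerGapHeat

open Summit.SmoothPoincare4.SmoothPoincare4.Theorems.NoncompactShrinkerGapCarrilloNiClauses


/-- **Helper `helper_positiveLSI_of_flow`** (line `collapsed-ends-usc`, v13; see the module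
docstring): on a complete connected normalised gradient shrinker, GIVEN the weighted heat flow from
the datum `c + ψ₀` (`c > 0`, `ψ₀ ≥ 0` smooth compactly supported) for every horizon `T > 0`, the
logarithmic Sobolev inequality `∫ ρ₀ log ρ₀ e^{-f} − m log(m/Z) ≤ ∫ |∇ρ₀|²/ρ₀ e^{-f}` holds for
`ρ₀ = c + ψ₀`. [cite: BakryGentilLedoux2014, Prop. 5.7.1] [cite: CarrilloNi2009, Thm. 3.1] -/
theorem helper_positiveLSI_of_flow : ∀ (n : ℕ) (M : Type) [TopologicalSpace M] [T2Space M] [SecondCountableTopology M] [ChartedSpace (EuclideanSpace ℝ (Fin n)) M] [IsManifold (𝓡 n) ∞ M] [ConnectedSpace M] [T3Space M] [MeasurableSpace M] [BorelSpace M] (g : PseudoRiemannianMetric (𝓡 n) ∞ (EuclideanSpace ℝ (Fin n)) (TangentSpace (𝓡 n) : M → Type _)) [g.HasLeviCivita] (f : M → ℝ) (hg : g.IsRiemannian), (∀ (x : M) (r : NNReal), IsCompact {y : M | g.edist hg x y ≤ r}) → ContMDiff (𝓡 n) 𝓘(ℝ, ℝ) ∞ f → (∀ (x : M) (X Y : TangentSpace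 (𝓡 n) x), g.ricci x X Y + g.hessian f x X Y = (1 / 2 : ℝ) * g.val x X Y) → (∀ x : M, g.scalarCurvature x + g.gradSq f x = f x) → ∀ (c : ℝ) (ψ₀ : M → ℝ), 0 < c → ContMDiff (𝓡 n) 𝓘(ℝ, ℝ) ∞ ψ₀ → HasCompactSupport ψ₀ → (∀ x, 0 ≤ ψ₀ x) → (∀ T : ℝ, 0 < T → ∃ (O : Set ℝ) (ρ : ℝ → M → ℝ), IsOpen O ∧ Icc 0 T ⊆ O ∧ ContMDiffOn ((𝓡 n).prod 𝓘(ℝ, ℝ)) 𝓘(ℝ, ℝ) ∞ (fun p : M × ℝ ↦ ρ p.2 p.1) (univ ×ˢ O) ∧ (∀ x, ρ 0 x = c + ψ₀ x) ∧ (∀ s ∈ Icc 0 T, ∀ x, deriv (fun r ↦ ρ r x) s = g.dalembertian (ρ s) x - g.innerDual x (mvfderiv (𝓡 n) f x).toLinearMap (mvfderiv (𝓡 n) (ρ s) x).toLinearMap) ∧ Integrable (fun p : M × ℝ ↦ (ρ p.2 p.1 - c) ^ 2 * Real.exp (-f p.1)) ((g.riemVolume.prod (volume : Measure ℝ)).restrict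 (univ ×ˢ Ioo 0 T))) → ∫ x, (c + ψ₀ x) * Real.log (c + ψ₀ x) * Real.exp (-f x) ∂g.riemVolume - (∫ x, (c + ψ₀ x) * Real.exp (-f x) ∂g.riemVolume) * Real.log ((∫ x, (c + ψ₀ x) * Real.exp (-f x) ∂g.riemVolume) / (∫ x, Real.exp (-f x) ∂g.riemVolume)) ≤ ∫ x, g.gradSq (fun y ↦ c + ψ₀ y) x / (c + ψ₀ x) * Real.exp (-f x) ∂g.riemVolume := by
  intro n M _ _ _ _ _ _ _ _ _ g _ f hg hc hf hsol hnorm c ψ₀ hc0 hψ hψc hψ0 hflow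
  classical
  haveI := CarrilloNi2009_shrinkerLSI.isFiniteMeasureOnCompacts_riemVolume hg
  /- the shrinker toolkit: `R ≥ 0`, `M` nonempty, `e^{-f} ∈ L¹`, `Z > 0`, `CD(½, ∞)` -/
  obtain ⟨-, hne, -⟩ := scalarCurvature_nonneg_and_isCompact_sublevel g f hg hc hf hsol hnorm
  haveI := hne
  have hZi : Integrable (fun x ↦ Real.exp (-f x)) g.riemVolume :=
    carrilloNi_integrable_exp_neg g f hg hc hf hsol hnorm
  have hRic : ∀ (x : M) (X : TangentSpace (𝓡 n) x),
      (1 / 2 : ℝ) * g.val x X X ≤ g.ricci x X X + g.hessian f x X X := fun x X ↦ (hsol x X X).ge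
  have hK : (0 : ℝ) < 1 / 2 := by norm_num
  /- the cut-offs `η_k` with `|Lη_k| ≤ 2C` -/
  obtain ⟨η, C, hηs, hηc, hη01, hηmono, hη1, -, hηΔ, hηf⟩ :=
    helper_shrinkerCutoff n M g f hg hc hf hsol hnorm
  have hη1' : ∀ x, ∀ᶠ k in atTop, ∀ᶠ y in 𝓝 x, η k y = 1 := fun x ↦ by
    filter_upwards [tendsto_natCast_atTop_atTop.eventually (eventually_gt_atTop (f x))] with k hk
    exact hη1 k x (by linarith)
  have hηL : ∀ k x, |g.dalembertian (η k) x - g.innerDual x (mvfderiv (𝓡 n) f x).toLinearMap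
      (mvfderiv (𝓡 n) (η k) x).toLinearMap| ≤ C + C := fun k x ↦
    (abs_sub _ _).trans (add_le_add (hηΔ k x) (hηf k x))
  /- bounds for the datum `ρ₀ = c + ψ₀`: `c ≤ ρ₀ ≤ c + S`, `|∇ρ₀|² ≤ G₀` -/
  obtain ⟨S, hS⟩ := hψ.continuous.bounded_above_of_compact_support hψc
  have hS0 : 0 ≤ S := (norm_nonneg _).trans (hS hne.some)
  have hψS : ∀ x, ψ₀ x ≤ S := fun x ↦ (Real.le_norm_self _).trans (hS x)
  have hgrad0 : ∀ x, g.gradSq (fun y ↦ c + ψ₀ y) x = g.gradSq ψ₀ x := fun x ↦ by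
    have h := PseudoRiemannianMetric.gradSq_real_comp (g := g) (I := 𝓡 n) (φ := ψ₀) (h := fun t ↦ c + t)
      (h' := 1) (x := x) ((hasDerivAt_id' (ψ₀ x)).const_add c) (hψ.mdifferentiableAt (by simp))
    simpa [Function.comp_def] using h
  have hgradc : HasCompactSupport (g.gradSq ψ₀) := by
    refine HasCompactSupport.intro hψc.isCompact fun x hx ↦ ?_
    exact innerDual_mvfderiv_eq_zero_of_notMem_tsupport_left (g := g) hx
  obtain ⟨G₁, hG₁⟩ := (contMDiff_gradSq g hψ).continuous.bounded_above_of_compact_support hgradc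
  set G₀ : ℝ := max G₁ 0 + 1 with hG₀def
  have hG₀pos : 0 < G₀ := by rw [hG₀def]; positivity
  have hG₀ : ∀ x, g.gradSq (fun y ↦ c + ψ₀ y) x ≤ G₀ := fun x ↦ by
    rw [hgrad0 x]
    have h1 : g.gradSq ψ₀ x ≤ G₁ := (Real.le_norm_self _).trans (hG₁ x)
    rw [hG₀def]
    linarith [le_max_left G₁ 0]
  /- notation -/
  set Z : ℝ := ∫ x, Real.exp (-f x) ∂g.riemVolume with hZdef
  set m : ℝ := ∫ x, (c + ψ₀ x) * Real.exp (-f x) ∂g.riemVolume with hmdef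
  /- the `ε`-argument -/
  refine le_of_forall_pos_le_add fun ε hε ↦ ?_
  obtain ⟨δ, hδ, hdec⟩ := helper_entropyDecay_static n M g f hg hc hf hsol hnorm c (c + S) ε hc0
    (by linarith) hε
  -- the horizon `T` with `e^{-T} G₀ ≤ δ`
  set T : ℝ := max 1 (Real.log (G₀ / δ)) with hTdef
  have hT : 0 < T := lt_of_lt_of_le one_pos (le_max_left _ _)
  have hTδ : Real.exp (-T) * G₀ ≤ δ := by
    have h1 : Real.exp (-T) ≤ Real.exp (-Real.log (G₀ / δ)) :=
      Real.exp_le_exp.2 (neg_le_neg (le_max_right _ _))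
    have h2 : Real.exp (-Real.log (G₀ / δ)) = δ / G₀ := by
      rw [Real.exp_neg, Real.exp_log (div_pos hG₀pos hδ), inv_div]
    calc Real.exp (-T) * G₀ ≤ Real.exp (-Real.log (G₀ / δ)) * G₀ :=
          mul_le_mul_of_nonneg_right h1 hG₀pos.le
      _ = δ := by rw [h2, div_mul_cancel₀ _ hG₀pos.ne']
  -- the flow on `[0, T]`
  obtain ⟨O, ρ, hO, hTO, hρ, hρ0, heq, hint⟩ := hflow T hT
  have hρ0' : ρ 0 = fun x ↦ c + ψ₀ x := funext hρ0
  have h0S : (0 : ℝ) ∈ Icc 0 T := ⟨le_rfl, hT.le⟩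
  have hTS : T ∈ Icc 0 T := ⟨hT.le, le_rfl⟩
  have hslice : ∀ t ∈ Icc 0 T, ContMDiff (𝓡 n) 𝓘(ℝ, ℝ) ∞ (ρ t) := fun t ht ↦
    hρ.comp_contMDiff (contMDiff_id.prodMk contMDiff_const) fun y ↦ ⟨mem_univ _, hTO ht⟩
  -- two-sided bounds `c ≤ ρ ≤ c + S`
  have hbd0 : ∀ x, c ≤ ρ 0 x ∧ ρ 0 x ≤ c + S := fun x ↦ by
    rw [hρ0 x]; exact ⟨by linarith [hψ0 x], by linarith [hψS x]⟩
  have hbd : ∀ s ∈ Icc 0 T, ∀ x, c ≤ ρ s x ∧ ρ s x ≤ c + S :=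
    helper_twoSidedBound n M g f hg hf hZi η (C + C) hηs hηc hη01 hηmono hη1' hηL T O ρ hT hO hTO hρ
      heq c c (c + S) le_rfl (by linarith) hbd0 hint
  -- the energy estimate: `|∇ρ|² e^{-f} ∈ L¹` of the strip
  have hint0 : Integrable (fun x ↦ (ρ 0 x - c) ^ 2 * Real.exp (-f x)) g.riemVolume := by
    have hcont : Continuous fun x ↦ (ρ 0 x - c) ^ 2 * Real.exp (-f x) := by
      rw [hρ0']
      exact ((continuous_const.add hψ.continuous).sub continuous_const).pow 2 |>.mul
        (Real.continuous_exp.comp hf.continuous.neg)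
    refine hcont.integrable_of_hasCompactSupport ?_
    refine HasCompactSupport.intro hψc.isCompact fun x hx ↦ ?_
    simp [hρ0 x, image_eq_zero_of_notMem_tsupport hx]
  obtain ⟨hgradInt, -⟩ :=
    helper_energyEstimate n M g f hg hf η (C + C) hηs hηc hη01 hηmono hη1' hηL T O ρ hT hO hTO hρ heq c
      hint hint0
  -- gradient decay `|∇ρ(s)|² ≤ e^{-s} G₀ ≤ G₀`
  have hG₀' : ∀ x, g.gradSq (ρ 0) x ≤ G₀ := fun x ↦ by rw [hρ0']; exact hG₀ x
  have hgd : ∀ s ∈ Icc 0 T, ∀ x, g.gradSq (ρ s) x ≤ Real.exp (-2 * (1 / 2) * s) * G₀ :=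
    helper_gradientDecay n M g f (1 / 2) hg hf hRic η (C + C) hηs hηc hη01 hηmono hη1' hηL T O ρ hT hO
      hTO hρ heq hgradInt G₀ hG₀'
  have hgradG : ∀ s ∈ Icc 0 T, ∀ x, g.gradSq (ρ s) x ≤ G₀ := fun s hs x ↦ by
    refine (hgd s hs x).trans ?_
    have h1 : Real.exp (-2 * (1 / 2) * s) ≤ 1 := by
      rw [Real.exp_le_one_iff]; nlinarith [hs.1]
    nlinarith [hG₀pos]
  have hgradT : ∀ x, g.gradSq (ρ T) x ≤ δ := fun x ↦ by
    refine (hgd T hTS x).trans ?_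
    have h1 : Real.exp (-2 * (1 / 2) * T) = Real.exp (-T) := by norm_num
    rw [h1]; exact hTδ
  -- conservation of mass
  have habs : ∀ s ∈ Icc 0 T, ∀ x, |ρ s x| ≤ c + S := fun s hs x ↦ by
    rw [abs_of_nonneg (hc0.le.trans (hbd s hs x).1)]; exact (hbd s hs x).2
  have hmass : ∫ x, ρ T x * Real.exp (-f x) ∂g.riemVolume = m := by
    rw [helper_massConservation n M g f hg hf hZi η (C + C) hηs hηc hη01 hηmono hη1' hηL T O ρ hT hO
      hTO hρ heq (c + S) habs T hTS, hρ0']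
  -- entropy dissipation `H(0) − H(T) ≤ I(0)` (`1/2K = 1`)
  have hdis := helper_entropyDissipation n M g f (1 / 2) hg hf hK hRic hZi η (C + C) hηs hηc hη01
    hηmono hη1' hηL T O ρ hT hO hTO hρ heq c (c + S) G₀ hc0 hbd hgradG
  -- static decay at time `T`
  have hdecT := hdec (ρ T) m (hslice T hTS) (hbd T hTS) hgradT hmass
  -- assemble
  rw [hρ0'] at hdis
  have h12 : (1 : ℝ) / (2 * (1 / 2)) = 1 := by norm_num
  rw [h12, one_mul] at hdis
  linarith [hdis, hdecT]

end Summit.SmoothPoincare4.SmoothPoincare4.Theorems.NoncompactShrinkerGapHeat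

end
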